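import Summits.Parity.GeneralizedHardyLittlewood.Theorems.BeyondDiagonalBeatsQuarter.OffDiagHeartCore
import HarnessLib

/-!
# Route `PrimeLevelFamEdge`, crux K_B (stmt-Parity-20343), line `diagonal_kernel_split` rev 4, plan Ω,
# **L9′ (shape) — the heart from (T), a FUNDED block part, and a RESIDUAL block part at clean scales**

Ω-h v4 (`OffDiagHeartCore`, p643105) reduced `stub_offDiagBelowSlack_io` to (T) (dual truncation, K1) and (Ω) a
block bound for the finite dual core `Σ_{q ∈ goodPrimes Δ′ N} offDiagCore Hf Δ′ q ≤ U·Σ ms` at clean scales.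
OMEGA-BLUEPRINT v4 / TRANSITION-SIZING (crux workfiles) split that block sum into FUNDED pieces (long-moduli
principal part `= 0` E14; short-moduli principal part in the closable regime; the conductor-`> N^δ` deviation via the
large sieve E18/L7a–d; the doubly-non-unit stratum) — each eventually `≤ ε·Σ ms` for every `ε > 0` — and a RESIDUAL
(the short-moduli transition row `(U)` and the small-conductor part `(S)`, both unfunded at quasi-GRH strength per the
memo §8–§9). This file fixes the GLUE so that the eventual kernel statement reads «stub ⇐ (T) ∧ (residual bound)»:

* **`offDiagBelowSlack_io_of_residual`** — for ANY decomposition `Σ_{q∈goodPrimes} offDiagCore Hf Δ′ q = F Δ′ N + Rsd Δ′ N`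
  on `Δ′ ∈ (1,2)`: if (T) holds, the funded part satisfies `∀ Δ′ ∈ (1,2) ∀ ε > 0, F Δ′ N ≤ ε·Σ ms` for all large `N`, and the
  residual satisfies the `c₀′`-first clean-scale block bound with SOME tolerance `U < 4(Δ′−1)/Δ′`, then the stub holds
  VERBATIM (the `ε` is absorbed into the slack: `U + ε < slack`);
* `offDiagBelowSlack_io_of_residual_a₀` — the same in the `a₀`-first shell.

Bookkeeping over p643105; nothing is claimed about `F` or `Rsd` (their definitions = `OffDiagCoreSplit`, their bounds =
L7d / A8P / the two research-grade residuals). Helper; closes nothing; standard axioms.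
«The programme SEARCHES and TYPES; no claim about Landau–Siegel zeros, Theorems 1–2 of arXiv:2211.02515 or
a repaired Margin232 until a kernel theorem says so.»
-/

noncomputable section

open Finset Polynomial
open scoped Real

namespace Summit.Parity.GeneralizedHardyLittlewood.Theorems.BeyondDiagonalBeatsQuarter.OffDiag

open Literature.NumberTheory.LFunctions Literature.NumberTheory.LFunctions.KMV2000
open PeterssonSplit (offDiag)

/-- Absorbing a funded `ε·Σms` part into the tolerance: if `B = F + R`, `F ≤ ε·m`, `R ≤ U·m` then `B ≤ (U + ε)·m`.
[folklore] -/
private theorem block_le_of_split {B F R U ε m : ℝ} (hsplit : B = F + R) (hF : F ≤ ε * m) (hR : R ≤ U * m) :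
    B ≤ (U + ε) * m := by
  rw [hsplit, add_mul]; linarith

/-- **L9′ (shape): the heart from (T), a funded block part and a residual block part at clean scales**
(`c₀′`-first shell). For a height function `Hf`, a decomposition `F + Rsd` of the block sum of the finite core on
`Δ′ ∈ (1,2)`, the truncation estimate (T), the funded estimate `F ≤ ε·Σms` (every `ε > 0`, all large `N`) and the
residual block bound at clean scales, `stub_offDiagBelowSlack_io` holds VERBATIM.
[cite: MontgomeryVaughan2007, Cor. 11.10 (Page); KowalskiMichelVanderKam2000, §6 p. 19 — derivation] -/
theorem offDiagBelowSlack_io_of_residual (Hf : ℕ → ℕ → ℕ → ℕ → ℕ → ℕ → ℕ × ℕ → ℕ)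
    (F Rsd : ℝ → ℕ → ℝ)
    (hT : ∀ Δ' : ℝ, 1 < Δ' → Δ' < 2 → ∀ ε : ℝ, 0 < ε → ∃ q₀ : ℕ, ∀ q : ℕ, q₀ ≤ q → q.Prime →
      |offDiagNearHead Δ' q - offDiagCore Hf Δ' q| ≤ ε * mainScaleReal Δ' q)
    (hsplit : ∀ Δ' : ℝ, 1 < Δ' → Δ' < 2 → ∀ N : ℕ,
      ∑ q ∈ goodPrimes Δ' N, offDiagCore Hf Δ' q = F Δ' N + Rsd Δ' N)
    (hF : ∀ Δ' : ℝ, 1 < Δ' → Δ' < 2 → ∀ ε : ℝ, 0 < ε → ∃ N₀ : ℕ, ∀ N : ℕ, N₀ ≤ N →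
      F Δ' N ≤ ε * ∑ q ∈ goodPrimes Δ' N, mainScaleReal Δ' q)
    (hR : ∀ c₀' : ℝ, 0 < c₀' → ∃ b : ℝ, 1 < b ∧ ∀ Δ' : ℝ, 1 < Δ' → Δ' < b →
      ∃ U : ℝ, U < 4 * (Δ' - 1) / Δ' ∧ ∃ a₀ : ℝ, 0 < a₀ ∧ ∃ η' : ℝ, 0 < η' ∧ η' < c₀' / a₀ ∧
        ∃ N₀ : ℕ, ∀ N : ℕ, N₀ ≤ N → CleanScale a₀ η' N →
          Rsd Δ' N ≤ U * ∑ q ∈ goodPrimes Δ' N, mainScaleReal Δ' q) :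
    ∃ b : ℝ, 1 < b ∧ ∀ Δ' : ℝ, 1 < Δ' → Δ' < b → ∃ U : ℝ, U < 4 * (Δ' - 1) / Δ' ∧
      ∀ q₀ : ℕ, ∃ q : ℕ, ∃ _ : NeZero q, q₀ ≤ q ∧ q.Prime ∧
        (∀ n : ℕ, (n : ℝ) ≠ qhat q ^ Δ') ∧
          -(∑ l ∈ Icc 1 ⌊qhat q ^ Δ'⌋₊, ∑ m ∈ Icc 1 ⌊qhat q ^ Δ'⌋₊,
              ((mollifierCoeff (X ^ 2) (qhat q ^ Δ') l * mollifierCoeff (X ^ 2) (qhat q ^ Δ') m : ℝ) : ℂ) *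
                offDiag q l m).re ≤ U * mainScaleReal Δ' q := by
  refine offDiagBelowSlack_io_of_coreBlockAtCleanScales Hf hT fun c₀' hc₀' ↦ ?_
  obtain ⟨b, hb, Hb⟩ := hR c₀' hc₀'
  -- shrink the window to `(1, min b 2)` so that `Δ′ < 2` is available for `hsplit`/`hF`
  refine ⟨min b 2, lt_min hb (by norm_num), fun Δ' h1 h2 ↦ ?_⟩
  have h2b : Δ' < b := lt_of_lt_of_le h2 (min_le_left _ _)
  have h22 : Δ' < 2 := lt_of_lt_of_le h2 (min_le_right _ _)
  obtain ⟨U, hU, a₀, ha₀, η', hη', hη'c, N₀, HN⟩ := Hb Δ' h1 h2b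
  -- absorb the funded part into the slack
  set ε : ℝ := (4 * (Δ' - 1) / Δ' - U) / 2 with hε
  have hεpos : 0 < ε := by rw [hε]; linarith
  obtain ⟨N₁, hN₁⟩ := hF Δ' h1 h22 ε hεpos
  refine ⟨U + ε, by rw [hε]; linarith, a₀, ha₀, η', hη', hη'c, max N₀ N₁, fun N hN hclean ↦ ?_⟩
  have hN0 : N₀ ≤ N := le_trans (le_max_left _ _) hN
  have hN1 : N₁ ≤ N := le_trans (le_max_right _ _) hN
  exact block_le_of_split (hsplit Δ' h1 h22 N) (hN₁ N hN1) (HN N hN0 hclean)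

/-- **L9′ (shape), `a₀`-first shell** of `offDiagBelowSlack_io_of_residual`.
[cite: MontgomeryVaughan2007, Cor. 11.10 (Page); KowalskiMichelVanderKam2000, §6 p. 19 — derivation] -/
theorem offDiagBelowSlack_io_of_residual_a₀ (Hf : ℕ → ℕ → ℕ → ℕ → ℕ → ℕ → ℕ × ℕ → ℕ)
    (F Rsd : ℝ → ℕ → ℝ)
    (hT : ∀ Δ' : ℝ, 1 < Δ' → Δ' < 2 → ∀ ε : ℝ, 0 < ε → ∃ q₀ : ℕ, ∀ q : ℕ, q₀ ≤ q → q.Prime →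
      |offDiagNearHead Δ' q - offDiagCore Hf Δ' q| ≤ ε * mainScaleReal Δ' q)
    (hsplit : ∀ Δ' : ℝ, 1 < Δ' → Δ' < 2 → ∀ N : ℕ,
      ∑ q ∈ goodPrimes Δ' N, offDiagCore Hf Δ' q = F Δ' N + Rsd Δ' N)
    (hF : ∀ Δ' : ℝ, 1 < Δ' → Δ' < 2 → ∀ ε : ℝ, 0 < ε → ∃ N₀ : ℕ, ∀ N : ℕ, N₀ ≤ N →
      F Δ' N ≤ ε * ∑ q ∈ goodPrimes Δ' N, mainScaleReal Δ' q)
    (hR : ∃ a₀ : ℝ, 0 < a₀ ∧ ∀ η₀ : ℝ, 0 < η₀ → ∃ b : ℝ, 1 < b ∧ ∀ Δ' : ℝ, 1 < Δ' → Δ' < b →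
      ∃ U : ℝ, U < 4 * (Δ' - 1) / Δ' ∧ ∃ η' : ℝ, 0 < η' ∧ η' < η₀ ∧ ∃ N₀ : ℕ, ∀ N : ℕ, N₀ ≤ N →
        CleanScale a₀ η' N →
          Rsd Δ' N ≤ U * ∑ q ∈ goodPrimes Δ' N, mainScaleReal Δ' q) :
    ∃ b : ℝ, 1 < b ∧ ∀ Δ' : ℝ, 1 < Δ' → Δ' < b → ∃ U : ℝ, U < 4 * (Δ' - 1) / Δ' ∧
      ∀ q₀ : ℕ, ∃ q : ℕ, ∃ _ : NeZero q, q₀ ≤ q ∧ q.Prime ∧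
        (∀ n : ℕ, (n : ℝ) ≠ qhat q ^ Δ') ∧
          -(∑ l ∈ Icc 1 ⌊qhat q ^ Δ'⌋₊, ∑ m ∈ Icc 1 ⌊qhat q ^ Δ'⌋₊,
              ((mollifierCoeff (X ^ 2) (qhat q ^ Δ') l * mollifierCoeff (X ^ 2) (qhat q ^ Δ') m : ℝ) : ℂ) *
                offDiag q l m).re ≤ U * mainScaleReal Δ' q := by
  refine offDiagBelowSlack_io_of_coreBlockAtCleanScales_a₀ Hf hT ?_
  obtain ⟨a₀, ha₀, Ha⟩ := hR
  refine ⟨a₀, ha₀, fun η₀ hη₀ ↦ ?_⟩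
  obtain ⟨b, hb, Hb⟩ := Ha η₀ hη₀
  refine ⟨min b 2, lt_min hb (by norm_num), fun Δ' h1 h2 ↦ ?_⟩
  have h2b : Δ' < b := lt_of_lt_of_le h2 (min_le_left _ _)
  have h22 : Δ' < 2 := lt_of_lt_of_le h2 (min_le_right _ _)
  obtain ⟨U, hU, η', hη', hη'c, N₀, HN⟩ := Hb Δ' h1 h2b
  set ε : ℝ := (4 * (Δ' - 1) / Δ' - U) / 2 with hε
  have hεpos : 0 < ε := by rw [hε]; linarith
  obtain ⟨N₁, hN₁⟩ := hF Δ' h1 h22 ε hεpos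
  refine ⟨U + ε, by rw [hε]; linarith, η', hη', hη'c, max N₀ N₁, fun N hN hclean ↦ ?_⟩
  have hN0 : N₀ ≤ N := le_trans (le_max_left _ _) hN
  have hN1 : N₁ ≤ N := le_trans (le_max_right _ _) hN
  exact block_le_of_split (hsplit Δ' h1 h22 N) (hN₁ N hN1) (HN N hN0 hclean)

end Summit.Parity.GeneralizedHardyLittlewood.Theorems.BeyondDiagonalBeatsQuarter.OffDiag
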